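import Mathlib
import Summits.PneNP.PneNP.Theorems.PstarUnionPin
import HarnessLib.Audit

/-!
# The pencil trichotomy split of the union lemma (ROUND-24, memo §14.12; ASK T-UNION-TRI of planner p3 g22)

FRONTIER range-avoidance ladder, rung F-N3, ROUND 24 (cell `pnp-ideate`, planner memo `r24/CORE-BOUND-NOTES.md` §14.12, typed sketch `r24/SketchTrichotomy.lean` of
planner p3 g22 — statements VERBATIM; restricted-model proof complexity — nothing here bears on `P` versus `NP`).

In a hun union-terminal configuration (`PstarUnion.UnionTerminal` + the admissibility hypotheses of `UnionFive`) the three pencil pairs `(A₀,w₂)`, `(A₁,w₂)`,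
`(A₀+A₁,w₂)` have necessity sets `P₀`, `P₁`, `R`; every output lies in at least two of them (`PstarUnionPin.release_of_cover_sdiff`,
`both_covers_of_not_release`).  TRICHOTOMY says one of the three is ALL of `J₀`; then `UnionFive` is immediate from the landed chain
(`card_le_five_of_terminal'` on that pair, resp. `PstarUnionPin.card_le_five_of_released`).  K20d census (NOR menu): no «genuine» configuration (all three proper)
at `k ≤ 5` (k = 6, 7 running at the time of writing).

* `UnionTrichotomy` (OPEN, `@[conjecture]`); `terminal_of_cover₀`, `terminal_of_cover₁`; `unionFive_of_trichotomy : UnionTrichotomy → UnionFive`.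
-/

set_option linter.dupNamespace false -- `Summit.PneNP.PneNP.…`: summit = sub-problem name (D-0017 single-conjunct layout)


open Finset Literature.Computability.Complexity
open Summit.PneNP.PneNP.Theorems.PstarTyped (Typed)
open Summit.PneNP.PneNP.Theorems.PstarSALevel (varSet bdry BoundaryExpanding SimpleOverlap)
open Summit.PneNP.PneNP.Theorems.PstarGapOneAll (gval)
open Summit.PneNP.PneNP.Theorems.PstarCoreBound (XorClosed)
open Summit.PneNP.PneNP.Theorems.PstarChordRepair (IsChord)
open Summit.PneNP.PneNP.Theorems.PstarChordBridgeCotree (Peelable)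
open Summit.PneNP.PneNP.Theorems.PstarChordBridgeTools (privs)
open Summit.PneNP.PneNP.Theorems.PstarCoreBoundTargets (Terminal card_le_five_of_terminal')
open Summit.PneNP.PneNP.Theorems.PstarUnion (SatPair UnionTerminal UnionFive)
open Summit.PneNP.PneNP.Theorems.PstarUnionPin (pinK card_le_five_of_released)

namespace Summit.PneNP.PneNP.Theorems.PstarUnionTrichotomy

variable {n m : ℕ}

/-- **PENCIL TRICHOTOMY (OPEN; conjectured from the K20d census).**  In a union-terminal core satisfying the admissibility hypotheses of
`UnionFive` (maximal peelable `F`, chords clean, monomials off the chord privates), one of the three pencil pairs `(A₀,w₂)`, `(A₁,w₂)`,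
`(A₀+A₁,w₂)` is solvable after deleting ANY single output of `J₀` (its necessity set is all of `J₀`).  FRONTIER. -/
@[conjecture] def UnionTrichotomy : Prop :=
  ∀ (n m r : ℕ) (I : LocalMap 4 n m), I.IsPure xorAndPred → Typed I → SimpleOverlap I → BoundaryExpanding r I →
  ∀ (y : Fin m → Bool) (J₀ : Finset (Fin m)) (A₀ A₁ w₂ : Finset (Fin n) × Finset (Fin m) × Bool),
    UnionTerminal I r y J₀ A₀ A₁ w₂ →
    ∀ F ⊆ J₀, Peelable I F → (∀ F', F ⊆ F' → F' ⊆ J₀ → Peelable I F' → F' = F) → (∀ e ∈ J₀ \ F, IsChord I J₀ e) →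
    (∀ g ∈ A₀.2.1 ∪ w₂.2.1, ∀ v ∈ privs I (J₀ \ F), I.vars g 2 ≠ v ∧ I.vars g 3 ≠ v) →
    (∀ f ∈ J₀, SatPair I y (J₀.erase f) A₀ w₂) ∨ (∀ f ∈ J₀, SatPair I y (J₀.erase f) A₁ w₂) ∨
    (∀ f ∈ J₀, SatPair I y (J₀.erase f) (pinK A₀ A₁) w₂)

/-- A union-terminal core on which the pair `(A₀, w₂)` is solvable after every single deletion is TERMINAL for that pair. -/
theorem terminal_of_cover₀ (I : LocalMap 4 n m) {r : ℕ} {y : Fin m → Bool} {J₀ : Finset (Fin m)}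
    {A₀ A₁ w₂ : Finset (Fin n) × Finset (Fin m) × Bool} (hU : UnionTerminal I r y J₀ A₀ A₁ w₂)
    (h₀ : ∀ f ∈ J₀, SatPair I y (J₀.erase f) A₀ w₂) : Terminal I r y J₀ A₀ w₂ := by
  obtain ⟨hne, hX, hJr, hG, hd₀, hd₂, hr, hxor, hn₀, hn₁, hcov⟩ := hU
  exact ⟨hne, hX, hJr, hd₀, hd₂, hr, hn₀, h₀⟩

/-- The same for the pair `(A₁, w₂)` (same monomials as `A₀`). -/
theorem terminal_of_cover₁ (I : LocalMap 4 n m) {r : ℕ} {y : Fin m → Bool} {J₀ : Finset (Fin m)}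
    {A₀ A₁ w₂ : Finset (Fin n) × Finset (Fin m) × Bool} (hU : UnionTerminal I r y J₀ A₀ A₁ w₂)
    (h₁ : ∀ f ∈ J₀, SatPair I y (J₀.erase f) A₁ w₂) : Terminal I r y J₀ A₁ w₂ := by
  obtain ⟨hne, hX, hJr, hG, hd₀, hd₂, hr, hxor, hn₀, hn₁, hcov⟩ := hU
  refine ⟨hne, hX, hJr, ?_, hd₂, ?_, hn₁, h₁⟩
  · rw [hG]; exact hd₀
  · rw [hG]; exact hr

/-- **`UnionFive` from PENCIL TRICHOTOMY** (the glue; the landed chain does the rest). -/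
theorem unionFive_of_trichotomy (h : UnionTrichotomy) : UnionFive := by
  intro n m r I hI hT hS hB y J₀ A₀ A₁ w₂ hU F hF hP hmax hchord hun
  have hG : A₁.2.1 = A₀.2.1 := hU.2.2.2.1
  rcases h n m r I hI hT hS hB y J₀ A₀ A₁ w₂ hU F hF hP hmax hchord hun with h₀ | h₁ | hR
  · exact card_le_five_of_terminal' I hI hT hS hB y (terminal_of_cover₀ I hU h₀) hF hP hmax hchord hun
  · refine card_le_five_of_terminal' I hI hT hS hB y (terminal_of_cover₁ I hU h₁) hF hP hmax hchord ?_
    rw [hG]; exact hun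
  · exact card_le_five_of_released I hI hT hS hB hU hR hF hP hmax hchord fun g hg => hun g (mem_union_right _ hg)

end Summit.PneNP.PneNP.Theorems.PstarUnionTrichotomy
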